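import Summits.SmoothPoincare4.SmoothPoincare4.Theorems.DottedCircleRasmussenDcrGapHelperFriendsCarrierTkAux9

/-!
# Helper `helper_friendsCarrier_Tk_endRange` of stub `helper_friendsCarrier_Tk` — the end collar, part 3: `collar ∘ collarInv = id` off the core
(item stmt-SmoothPoincare4-16128, route route-SmoothPoincare4-DottedCircleRasmussen)

Continuation of `…TkAux8–9` (end collar, parts 1–2), porting the sections *`collar ∘ collarInv = id`
off the core* and *The collar misses the core* of the tree's `OpenTraceCollar.lean`:

* `EndDatum.Presentation.collar_collarInv` — `collar (collarInv z) = z` for `z ∉ C` (three cases: a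
  `0`-handle-chart point whose drop is outside / inside the closed tube, a cocore point);
* `EndDatum.Presentation.collar_not_mem_trCore`, `range_collar` — the collar takes values off the core
  `C = incl(D_k) ∪ coreDisc(𝔻²)`, and **`range collar = Cᶜ`**;
* `helper_friendsCarrier_Tk_endRange` — the registered summary: a bijection `Y × ℝ ≅ T ∖ C`.

Everything is proved; no named facts, no `sorry`.
References: Kirby (1989), Ch. I §5 [Kirby1989]; the tree's `OpenTraceCollar.lean`, `TraceCollarProfile.lean`.
-/

-- the prescribed namespace `Summit.<P>.<Sub>.…` duplicates `SmoothPoincare4` (P = Sub)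
set_option linter.dupNamespace false
set_option linter.style.longLine false

noncomputable section

open scoped Manifold ContDiff Topology
open Function Set Metric
open Literature.Topology.FourManifolds Literature.Topology.FourManifolds.MMSW

namespace Summit.SmoothPoincare4.SmoothPoincare4.Theorems.DcrGap.MkFriends

namespace FriendsTk

namespace EndDatum

variable {k : ℕ} (E : EndDatum k)

/-! ### Points off the core in collar coordinates -/

/-- The zero section of the trace's (shrunken) tube is the knot: `νK (u, 0) = K₀ u`. [folklore] -/
theorem νK_zero (u : Metric.sphere (0 : EuclideanSpace ℝ (Fin 2)) 1) : E.νK (u, 0) = E.K₀ u := by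
  rw [E.νK_eq]; simp only [OpenPartialHomeomorph.univBall_apply_zero]; exact E.ν₀_zero u

/-- `θ(s, ·)` is injective. [folklore] -/
theorem θ_injective (s : ℝ) : Injective fun x => E.θ (s, x) := fun x y h => by
  have := congrArg (fun z => E.θ (-s, z)) h
  simpa only [E.θ_neg_θ] using this

/-- **Collar coordinates of a `0`-handle-chart point off the core.**  If `y ∈ P`, `G_k y > 1` and `y` is
off the collar cylinder over the knot, then with `α = E(G_k y - 1) ∈ (0, 1)` and `a = drop y ∈ M_k ∖ K₀`:
`y = θ(s(α), a)`. [folklore] -/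
theorem offCore_coords {y : EuclideanSpace ℝ (Fin 4)} (hy : y ∈ E.hbNbhd) (h1 : 1 < levelFun k y)
    (h2 : ∀ (u : Metric.sphere (0 : EuclideanSpace ℝ (Fin 2)) 1) (s : ℝ), 0 ≤ s → s < E.δ → y ≠ E.θ (s, E.νK (u, 0))) :
    0 < E.radA y ∧ E.radA y < 1 ∧ E.dropA y ∈ modelBoundary k ∧ E.dropA y ∉ range E.K₀ ∧
      y = E.θ (E.collarTime (E.radA y), E.dropA y) := by
  have hs : levelFun k y - 1 ∈ Ioo (-E.δ) E.δ := ⟨by linarith [E.δ_pos], by linarith [hy.2]⟩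
  have hspos : 0 < levelFun k y - 1 := by linarith
  have hG : levelFun k y ∈ Ioo (1 - E.δ) (1 + E.δ) := ⟨by linarith [E.δ_pos], hy.2⟩
  obtain ⟨hdrop, hyeq⟩ := E.drop_mem_modelBoundary hy.1 hG
  have hα : 0 < E.radA y := E.handleRadius_pos hs
  have hα1 : E.radA y < 1 := by
    rw [radA, TraceDatum.handleRadius, div_lt_one (by linarith [hs.1])]; linarith
  have hct : E.collarTime (E.radA y) = levelFun k y - 1 := E.collarTime_handleRadius hs
  refine ⟨hα, hα1, hdrop, ?_, by rw [hct, dropA]; exact hyeq.symm⟩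
  rintro ⟨u, hu⟩
  refine h2 u (levelFun k y - 1) hspos.le hs.2 ?_
  rw [E.νK_zero, hu, dropA]; exact hyeq.symm

/-- **A collar point `ptA α a` (`a ∈ M_k ∖ K₀`, `0 < α < 1`) is off the core.** [folklore] -/
theorem ptA_not_mem_trCore {a : EuclideanSpace ℝ (Fin 4)} (ha : a ∈ modelBoundary k) (ha' : a ∉ range E.K₀) {α : ℝ}
    (hα : 0 < α) (hα1 : α < 1) : E.ptA α a ∉ E.trCore := by
  have hs := E.collarTime_mem_Ioo hα
  have hspos : 0 < E.collarTime α := by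
    by_contra h; push Not at h
    exact absurd ((E.collarTime_nonpos_iff hα.le).1 h) (not_le.2 hα1)
  obtain ⟨-, -, hG⟩ := E.dropA_radA_θ ha hs
  rw [ptA, E.incl_mem_trCore_iff (E.θ_mem_hbNbhd_of_mem ha hs), not_or]
  refine ⟨fun hD => absurd ((E.mem_modelHandlebody_iff a ha _ hs).1 hD) (not_le.2 hspos), ?_⟩
  rintro ⟨u, s, hs0, hsδ, heq⟩
  have hs' : s ∈ Ioo (-E.δ) E.δ := ⟨by linarith [E.δ_pos], hsδ⟩
  -- the clock reads off `s`, then `θ(s, ·)` is injective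
  obtain ⟨-, hG'⟩ := E.clock_νK (u, 0) hs'
  have e1 : levelFun k (E.θ (s, E.νK (u, 0))) = 1 + E.collarTime α := by rw [← heq]; exact hG
  have hss : E.collarTime α = s := by linarith
  rw [hss] at heq
  exact ha' ⟨u, by rw [← E.νK_zero]; exact (E.θ_injective s heq).symm⟩

/-- The flat formula on the core circle of the surgery torus takes values off the core. [folklore] -/
theorem cFlat_zero_not_mem_trCore (v : Metric.sphere (0 : EuclideanSpace ℝ (Fin 2)) 1) (σ : ℝ) :
    E.cFlat ((0 : EuclideanSpace ℝ (Fin 2)), v) σ ∉ E.trCore := by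
  have hrpos : 0 < 2 * Real.exp (-TraceCollar.ψinv (Real.exp (-σ))) := by positivity
  have hYd : 0 < TraceCollar.ψinv (Real.exp (-σ)) := TraceCollar.ψinv_pos _
  have hr2 : 2 * Real.exp (-TraceCollar.ψinv (Real.exp (-σ))) < 2 := by
    have : Real.exp (-TraceCollar.ψinv (Real.exp (-σ))) < 1 := Real.exp_lt_one_iff.2 (by linarith)
    linarith
  have hrv : ‖(2 * Real.exp (-TraceCollar.ψinv (Real.exp (-σ)))) • (v : EuclideanSpace ℝ (Fin 2))‖ < 2 := by
    rwa [norm_smul_coe_sphere hrpos.le]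
  rw [cFlat, TubeNbhd.fF]
  simp only [smul_zero]
  rw [E.inr_zero_mem_trCore_iff]
  intro h
  have := congrArg (OpenPartialHomeomorph.univBall (0 : EuclideanSpace ℝ (Fin 2)) 2) h
  rw [TubeNbhd.univBall_apply_symm_apply hrv, OpenPartialHomeomorph.univBall_apply_zero] at this
  exact smul_ne_zero hrpos.ne' (ne_zero_of_mem_unit_sphere v) this

namespace Presentation

variable {E} {Y : Type*} [TopologicalSpace Y] [ChartedSpace (EuclideanSpace ℝ (Fin 3)) Y] (P : E.Presentation Y)

/-! ### `collar ∘ collarInv = id` off the core -/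

/-- **Branch R'**: `collar (collarInv (incl y)) = incl y` when the drop of `y` is outside the closed tube. [folklore] -/
theorem collar_collarInv_rad {y : EuclideanSpace ℝ (Fin 4)} (hy : y ∈ E.hbNbhd) (h1 : 1 < levelFun k y)
    (h2 : ∀ (u : Metric.sphere (0 : EuclideanSpace ℝ (Fin 2)) 1) (s : ℝ), 0 ≤ s → s < E.δ → y ≠ E.θ (s, E.νK (u, 0)))
    (h : E.dropA y ∉ E.closedTube) :
    E.collar P.jM P.jB P.ψ (E.collarInv P.jM P.jB (E.incl y)) = E.incl y := by
  obtain ⟨hα, hα1, ha, -, hyeq⟩ := E.offCore_coords hy h1 h2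
  rw [E.collarInv_incl_of_not_mem P.jM P.jB hy h1 h, ΨRad, P.collar_of_not_mem_closedTube ha h, cRad]
  conv_rhs => rw [hyeq]
  simp only [neg_neg]
  rw [Real.exp_log (TraceCollar.ξ_pos hα hα1), TraceCollar.αof_ξ hα.le hα1, ptA]

/-- **Branch P'**: `collar (collarInv (incl y)) = incl y` when the drop of `y` is in the closed tube. [folklore] -/
theorem collar_collarInv_tube {y : EuclideanSpace ℝ (Fin 4)} (hy : y ∈ E.hbNbhd) (h1 : 1 < levelFun k y)
    (h2 : ∀ (u : Metric.sphere (0 : EuclideanSpace ℝ (Fin 2)) 1) (s : ℝ), 0 ≤ s → s < E.δ → y ≠ E.θ (s, E.νK (u, 0)))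
    (h : E.dropA y ∈ E.closedTube) :
    E.collar P.jM P.jB P.ψ (E.collarInv P.jM P.jB (E.incl y)) = E.incl y := by
  obtain ⟨hα, hα1, -, hrange, hyeq⟩ := E.offCore_coords hy h1 h2
  -- write the drop as `ν₀ (u, w)` with `0 < ‖w‖ ≤ 2`
  obtain ⟨⟨u, w⟩, ⟨-, hw2⟩, hqa⟩ := h
  rw [Metric.mem_closedBall, dist_zero_right] at hw2
  have hw : w ≠ 0 := fun h0 => hrange (by rw [← hqa, h0]; exact E.ν₀_mem_range_iff.2 rfl)
  have hwpos : 0 < ‖w‖ := norm_pos_iff.2 hw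
  set α : ℝ := E.radA y with hαdef
  have hyeq' : y = E.θ (E.collarTime α, E.ν₀ (u, ‖w‖ • ((radialProjection (spherePt 1) w :
      Metric.sphere (0 : EuclideanSpace ℝ (Fin 2)) 1) : EuclideanSpace ℝ (Fin 2)))) := by
    rw [norm_smul_coe_radialProjection, hqa]; exact hyeq
  -- the profile point
  set q : ℝ × ℝ := (TraceCollar.ξ α, Real.log (2 / ‖w‖)) with hqdef
  have hqpos : q ∈ TraceCollar.Ωpos := TraceCollar.ξ_pos hα hα1
  have hY : 0 ≤ q.2 := by
    show 0 ≤ Real.log (2 / ‖w‖)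
    exact Real.log_nonneg ((le_div_iff₀ hwpos).2 (by linarith))
  have hNT : TraceCollar.Φ q ∈ TraceCollar.Quad := TraceCollar.Φ_mem_Quad hqpos
  have hN : 0 < (TraceCollar.Φ q).1 := hNT.1
  have hT : 0 < (TraceCollar.Φ q).2 := hNT.2
  have hT2 : (TraceCollar.Φ q).2 ≤ 2 := by
    refine (TubeNbhd.Tf_le q).trans ?_
    have : Real.exp (-q.2) ≤ 1 := Real.exp_le_one_iff.2 (by linarith)
    linarith
  -- evaluate `collarInv`
  rw [E.collarInv_incl_of_mem P.jM P.jB hy ⟨(u, w), ⟨mem_univ _, by simpa using hw2⟩, hqa⟩]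
  conv_lhs => rw [hyeq']
  rw [E.ΨTube_ptT_arg P.jM hα hwpos, ← hqdef, ptY]
  -- evaluate `collar` (branch P at the new point)
  have hmem : E.ν₀ (u, (TraceCollar.Φ q).2 • ((radialProjection (spherePt 1) w : Metric.sphere (0 : EuclideanSpace ℝ (Fin 2)) 1) :
      EuclideanSpace ℝ (Fin 2))) ∈ E.closedTube := by
    rw [mem_closedTube_iff, norm_smul_coe_sphere hT.le]; exact hT2
  rw [P.collar_of_mem_closedTube (E.ν₀_mem _) (E.ν₀_smul_not_mem_range hT.ne' _ _) hmem, cTube_apply]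
  have hbase : E.baseP (E.ν₀ (u, (TraceCollar.Φ q).2 • ((radialProjection (spherePt 1) w : Metric.sphere (0 : EuclideanSpace ℝ (Fin 2)) 1) :
      EuclideanSpace ℝ (Fin 2)))) (-Real.log (TraceCollar.Φ q).1) = q := by
    rw [baseP_apply, neg_neg, Real.exp_log hN, norm_smul_coe_sphere hT.le, Prod.mk.eta, TraceCollar.Φinv_Φ hqpos]
  rw [hbase, radialProjection_smul _ hT, ptT, hyeq']
  congr 2
  · rw [show q.1 = TraceCollar.ξ α from rfl, TraceCollar.αof_ξ hα.le hα1]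
  · rw [show q.2 = Real.log (2 / ‖w‖) from rfl, TubeNbhd.two_mul_exp_neg_log hwpos]

/-- **Branch F'**: `collar (collarInv z) = z` on the cocore. [folklore] -/
theorem collar_collarInv_cocore {w : EuclideanSpace ℝ (Fin 2)} (hw : w ≠ 0) :
    E.collar P.jM P.jB P.ψ (E.collarInv P.jM P.jB (E.trGlueData.inr (0, w))) = E.trGlueData.inr (0, w) := by
  set w' := OpenPartialHomeomorph.univBall (0 : EuclideanSpace ℝ (Fin 2)) 2 w with hw'def
  have hw' : w' ≠ 0 := TubeNbhd.univBall_ne_zero hw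
  have hw'pos : 0 < ‖w'‖ := norm_pos_iff.2 hw'
  have hw'2 : ‖w'‖ < 2 := TubeNbhd.norm_univBall_lt w
  have hYy : 0 < Real.log (2 / ‖w'‖) := Real.log_pos ((lt_div_iff₀ hw'pos).2 (by linarith))
  have hψ : 0 < TraceCollar.ψ (Real.log (2 / ‖w'‖)) := TraceCollar.ψ_pos hYy
  have hsolid : ((0 : EuclideanSpace ℝ (Fin 2)), radialProjection (spherePt 1) w') ∈ solidTorus := by
    simp [mem_solidTorus_iff]
  rw [E.collarInv_inr_zero, TubeNbhd.ΨFlat]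
  simp only [smul_zero]
  rw [show TubeNbhd.radF ((0 : EuclideanSpace ℝ (Fin 2)), w) = ‖w'‖ from rfl, TubeNbhd.jBt_of_norm_lt P.jB (by simp),
    P.collar_of_core _ hsolid, cFlat, TubeNbhd.fF]
  simp only [smul_zero, neg_neg]
  rw [Real.exp_log hψ, TraceCollar.ψinv_ψ hYy, TubeNbhd.two_mul_exp_neg_log hw'pos, norm_smul_coe_radialProjection,
    hw'def, TubeNbhd.univBall_symm_apply_apply]

/-- **`collar ∘ collarInv = id` off the core.** [folklore] -/
theorem collar_collarInv {z : E.Trace} (hz : z ∉ E.trCore) : E.collar P.jM P.jB P.ψ (E.collarInv P.jM P.jB z) = z := by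
  rcases E.exists_of_not_mem_trCore hz with ⟨y, hy, h1, h2, rfl⟩ | ⟨w, hw, rfl⟩
  · by_cases h : E.dropA y ∈ E.closedTube
    · exact P.collar_collarInv_tube hy h1 h2 h
    · exact P.collar_collarInv_rad hy h1 h2 h
  · exact P.collar_collarInv_cocore hw

/-! ### The collar misses the core; its range -/

/-- **The collar misses the core.** [folklore] -/
theorem collar_not_mem_trCore (p : Y × ℝ) : E.collar P.jM P.jB P.ψ p ∉ E.trCore := by
  obtain ⟨y, σ⟩ := p
  by_cases hy : y ∈ E.mSet P.jM
  · obtain ⟨a, ⟨ha, ha'⟩, rfl⟩ := hy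
    by_cases hat : a ∈ E.closedTube
    · rw [P.collar_of_mem_closedTube ha ha' hat σ]
      obtain ⟨⟨u, w⟩, -, hqa⟩ := hat
      have hw : w ≠ 0 := fun h0 => ha' (by rw [← hqa, h0]; exact E.ν₀_mem_range_iff.2 rfl)
      have hr : 0 < 2 * Real.exp (-(E.baseP (E.ν₀ (u, w)) σ).2) := by positivity
      rw [← hqa, cTube_apply, ptT]
      exact E.ptA_not_mem_trCore (E.ν₀_mem _) (E.ν₀_smul_not_mem_range hr.ne' _ _)
        (TraceCollar.αof_pos (E.baseP_mem_Ωpos u hw σ)) (TraceCollar.αof_lt_one _)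
    · rw [P.collar_of_not_mem_closedTube ha hat σ]
      exact E.ptA_not_mem_trCore ha ha' (TraceCollar.αof_pos (Real.exp_pos _)) (TraceCollar.αof_lt_one _)
  · obtain ⟨v, h, rfl⟩ := P.eq_jB_zero_of_not_mem hy
    rw [P.collar_of_core v h σ]; exact E.cFlat_zero_not_mem_trCore v σ

/-- The inverse collar is injective off the core. [folklore] -/
theorem collarInv_injOn : InjOn (E.collarInv P.jM P.jB) (E.trCore)ᶜ := fun z hz z' hz' h => by
  rw [← P.collar_collarInv hz, ← P.collar_collarInv hz', h]

/-- **The image of the collar is exactly the complement of the core.** [folklore] -/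
theorem range_collar : range (E.collar P.jM P.jB P.ψ) = (E.trCore)ᶜ := by
  refine Subset.antisymm ?_ ?_
  · rintro _ ⟨p, rfl⟩; exact P.collar_not_mem_trCore p
  · intro z hz; exact ⟨_, P.collar_collarInv hz⟩

end Presentation

end EndDatum

end FriendsTk

/-- **Helper `helper_friendsCarrier_Tk_endRange`** (registered on the crux item; end collar part 3 of
stub `helper_friendsCarrier_Tk`): the collar `c : Y × ℝ → T` of the relative open trace is a BIJECTION
onto the complement of the compact core `C = i(D_k) ∪ f₀(𝔻²)` (`f₀` the core disc), with inverse
`collarInv`: `collarInv ∘ c = id`, `c ∘ collarInv = id` off `C`, `range c = Cᶜ` (Kirby 1989, Ch. I §5: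
the end of the trace of a surgery is `Y × ℝ`). [cite: Kirby1989, Ch. I §5] -/
theorem helper_friendsCarrier_Tk_endRange : ∀ (k : ℕ) (K₀ : (sphere (0 : EuclideanSpace ℝ (Fin 2)) 1) → EuclideanSpace ℝ (Fin 4)) (ν₀ νK : (sphere (0 : EuclideanSpace ℝ (Fin 2)) 1) × EuclideanSpace ℝ (Fin 2) → EuclideanSpace ℝ (Fin 4)) (θ : ℝ × EuclideanSpace ℝ (Fin 4) → EuclideanSpace ℝ (Fin 4)) (δ : ℝ) (ι ι₀ : EuclideanSpace ℝ (Fin 4) → (sphere (0 : EuclideanSpace ℝ (Fin 2)) 1) × EuclideanSpace ℝ (Fin 2)), 0 < δ → δ < 1 → ContDiff ℝ ((⊤ : ℕ∞) : WithTop ℕ∞) θ → (∀ x, θ (0, x) = x) → (∀ t s x, θ (t, θ (s, x)) = θ (t + s, x)) → (∀ y : EuclideanSpace ℝ (Fin 4), (∀ j, (1 : ℝ) / 2 < holeTerm k j y) → levelFun k y ∈ Ioo (1 - δ) (1 + δ) → ∀ t : ℝ, levelFun k y + t ∈ Ioo (1 - δ) (1 + δ) → (∀ j, (1 : ℝ)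 / 2 < holeTerm k j (θ (t, y))) ∧ levelFun k (θ (t, y)) = levelFun k y + t) → (∀ a ∈ modelBoundary k, ∀ s ∈ Ioo (-δ) δ, (θ (s, a) ∈ modelHandlebody k ↔ s ≤ 0)) → ContMDiff ((𝓡 1).prod 𝓘(ℝ, EuclideanSpace ℝ (Fin 2))) 𝓘(ℝ, EuclideanSpace ℝ (Fin 4)) ((⊤ : ℕ∞) : WithTop ℕ∞) νK → (∀ p, νK p ∈ modelBoundary k) → IsOpen {y : EuclideanSpace ℝ (Fin 4) | (∀ j, (1 : ℝ) / 2 < holeTerm k j y) ∧ levelFun k y ∈ Ioo (1 - δ) (1 + δ) ∧ θ (1 - levelFun k y, y) ∈ range νK} → ContMDiffOn 𝓘(ℝ, EuclideanSpace ℝ (Fin 4)) ((𝓡 1).prod 𝓘(ℝ, EuclideanSpace ℝ (Fin 2))) ((⊤ : ℕ∞) : WithTop ℕ∞) ι {y : EuclideanSpace ℝ (Fin 4) | (∀ j, (1 : ℝ) / 2 < holeTerm k j y) ∧ levelFun k y ∈ Ioo (1 - δ) (1 + δ) ∧ θ (1 - levelFun k y, y) ∈ range νK} → (∀ q s, s ∈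 Ioo (-δ) δ → ι (θ (s, νK q)) = q) → (∀ y ∈ {y : EuclideanSpace ℝ (Fin 4) | (∀ j, (1 : ℝ) / 2 < holeTerm k j y) ∧ levelFun k y ∈ Ioo (1 - δ) (1 + δ) ∧ θ (1 - levelFun k y, y) ∈ range νK}, θ (levelFun k y - 1, νK (ι y)) = y) → (∀ q, νK q = ν₀ (q.1, OpenPartialHomeomorph.univBall (0 : EuclideanSpace ℝ (Fin 2)) 2 q.2)) → ContMDiff ((𝓡 1).prod 𝓘(ℝ, EuclideanSpace ℝ (Fin 2))) 𝓘(ℝ, EuclideanSpace ℝ (Fin 4)) ((⊤ : ℕ∞) : WithTop ℕ∞) ν₀ → Injective ν₀ → (∀ p, ν₀ p ∈ modelBoundary k) → (∀ u, ν₀ (u, 0) = K₀ u) → IsOpen {y : EuclideanSpace ℝ (Fin 4) | (∀ j, (1 : ℝ) / 2 < holeTerm k j y) ∧ levelFun k y ∈ Ioo (1 - δ) (1 + δ) ∧ θ (1 - levelFun k y, y) ∈ range ν₀} → ContMDiffOn 𝓘(ℝ, EuclideanSpace ℝ (Fin 4)) ((𝓡 1).prod 𝓘(ℝ, EuclideanSpace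 ℝ (Fin 2))) ((⊤ : ℕ∞) : WithTop ℕ∞) ι₀ {y : EuclideanSpace ℝ (Fin 4) | (∀ j, (1 : ℝ) / 2 < holeTerm k j y) ∧ levelFun k y ∈ Ioo (1 - δ) (1 + δ) ∧ θ (1 - levelFun k y, y) ∈ range ν₀} → (∀ q s, s ∈ Ioo (-δ) δ → ι₀ (θ (s, ν₀ q)) = q) → ∀ (Y : Type) [TopologicalSpace Y] [ChartedSpace (EuclideanSpace ℝ (Fin 3)) Y] (jB : solidTorus → Y) (jM : EuclideanSpace ℝ (Fin 4) → Y) (ψ : Y → EuclideanSpace ℝ (Fin 4)), Injective jB → (∀ x ∈ modelBoundary k, x ∉ range K₀ → ψ (jM x) = x) → jM '' {x : EuclideanSpace ℝ (Fin 4) | x ∈ modelBoundary k ∧ x ∉ range K₀} ∪ range jB = univ → (∀ x ∈ modelBoundary k, x ∉ range K₀ → ∀ b : solidTorus, jM x = jB b ↔ ∃ (u : (sphere (0 : EuclideanSpace ℝ (Fin 2)) 1)) (t : ℝ), t ∈ Ioo (0 : ℝ) 1 ∧ b.1.1 = t • (u : EuclideanSpace ℝ (Fin 2)) ∧ x = ν₀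 (u, t • (b.1.2 : EuclideanSpace ℝ (Fin 2)))) → ∃ (X : Type) (_ : TopologicalSpace X) (_ : T2Space X) (_ : ChartedSpace (EuclideanSpace ℝ (Fin 4)) X) (_ : IsManifold (𝓡 4) ((⊤ : ℕ∞) : WithTop ℕ∞) X) (i : EuclideanSpace ℝ (Fin 4) → X) (h : EuclideanSpace ℝ (Fin 2) × EuclideanSpace ℝ (Fin 2) → X) (f₀ : EuclideanSpace ℝ (Fin 2) → X) (c : Y × ℝ → X) (cinv : X → Y × ℝ), (∀ x, f₀ x = h (x, 0)) ∧ (∀ p, cinv (c p) = p) ∧ (∀ z, z ∉ (i '' modelHandlebody k ∪ f₀ '' closedBall (0 : EuclideanSpace ℝ (Fin 2)) 1) → c (cinv z) = z) ∧ range c = (i '' modelHandlebody k ∪ f₀ '' closedBall (0 : EuclideanSpace ℝ (Fin 2)) 1)ᶜ ∧ IsCompact (i '' modelHandlebody k ∪ f₀ '' closedBall (0 : EuclideanSpace ℝ (Fin 2)) 1) := by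
  intro k K₀ ν₀ νK θ δ ι ι₀ hδ hδ1 hθ h0 hadd hclock hiff hν hmem hopen hι hιθ hθι hνK hν₀ hinj₀ hmem₀ hK₀ hopen₀ hι₀ hιθ₀
    Y _ _ jB jM ψ hjB hψ hcov hrel
  let E : FriendsTk.EndDatum k :=
    { νK := νK, θ := θ, δ := δ, ι := ι, δ_pos := hδ, δ_lt_one := hδ1, contDiff_θ := hθ, θ_zero := h0, θ_add := hadd,
      clock := hclock, mem_modelHandlebody_iff := hiff, contMDiff_νK := hν, νK_mem := hmem, isOpen_flowTube' := hopen,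
      contMDiffOn_ι := hι, ι_θ := hιθ, θ_ι := hθι, ν₀ := ν₀, K₀ := K₀, ι₀ := ι₀, νK_eq := hνK, contMDiff_ν₀ := hν₀,
      injective_ν₀ := hinj₀, ν₀_mem := hmem₀, ν₀_zero := hK₀, isOpen_flowTube₀ := hopen₀, contMDiffOn_ι₀ := hι₀,
      ι₀_θ := hιθ₀ }
  let P : E.Presentation Y := ⟨jM, jB, ∅, ψ, hjB, hψ, hcov, hrel⟩
  exact ⟨E.Trace, inferInstance, inferInstance, inferInstance, inferInstance, E.incl, E.trGlueData.inr, E.coreDisc,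
    E.collar P.jM P.jB P.ψ, E.collarInv P.jM P.jB, fun x => rfl, P.collarInv_collar, fun z hz => P.collar_collarInv hz,
    P.range_collar, E.isCompact_trCore⟩

end Summit.SmoothPoincare4.SmoothPoincare4.Theorems.DcrGap.MkFriends

end
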